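import Literature.Probability.RandomPlanarGeometry.HexSAWStripWidthTwo
import HarnessLib

/-!
# The width-two strip of the hexagonal lattice, solved: `B_{2,L}(x) ↑ P_B(x)/Q(x)` and `A_{2,L}(x) ↑ P_A(x)/Q(x)`
# for every subcritical fugacity, and divergence at the inverse plastic number

Topic `Literature/Probability/RandomPlanarGeometry` (continues `HexSAWStripWidthTwo.lean`: the ladder coordinates
`W2.lad`/`W2.LAdj`, the excursion–weave–excursion families `W2.encode`/`W2.famWalk`, the parameter sets
`W2.paramsB`/`W2.paramsA`, their closed generating sums and the LOWER bounds `W2.sum_paramsB_le_stripB`,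
`W2.limB_le_of_stripB_le`; there the values at `x_c` were pinned by the Duminil-Copin–Smirnov strip identity).
Sources: H. Duminil-Copin, S. Smirnov, Ann. of Math. 175 (2012), §3 (the strips `S_{T,L}`, `A_{T,L}`,
`B_{T,L}`); N. R. Beaton, A. J. Guttmann, I. Jensen, J. Phys. A 45 (2012) 035201 (arXiv:1110.1141), §2, where
the rational generating functions of this strip — `B(z) = 2z⁴(2−4z⁴+2z⁶+2z⁸−z¹⁰)/((1−z⁴)²(1−2z²+z⁴−z⁶))`,
`A(z) = 2z³(1−z²+z⁴+3z⁶−4z⁸+z¹²)/(same)` (their "width 1" = width 2 here) — are REPORTED as transfer-matrix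
enumeration output, without proof, together with "the dominant pole being at `z = z_c(T)`".

THIS FILE PROVES THEM. The missing half is COMPLETENESS of the families: every self-avoiding mid-edge walk
of `S_{2,L}` from `a` to `β` or `α` is one of the excursion–weave–excursion walks. The proof is an invariant
on prefixes (§12–§14): read in ladder coordinates (§11: `W2.toAbs`, `W2.LAdj_of_adj`, `W2.exists_abs_of_mem`),
every prefix of such a walk is, up to the mirror `p ↦ −p`, of shape T3 = (origin, optional left excursion,
weave, partial block) or T4 = (…, weave, `n` straight blocks, the turning rung, a return run) — `W2.Shp` —,
the shape is preserved by each step to a fresh neighbour (`W2.Shp.step`: fifteen cases; a U-turn of the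
initial straight run re-reads as a left excursion with the mirror flipped, a U-turn after a rail switch is
trapped above the switch and can only run back and exit), and a complete shape ending at an even position IS
an encoded family walk (`W2.Shp.finish`, `W2.shapeT4_eq_encode`). Hence (§15) `W2.exists_param_of_mem`: the
`β`-walks of `S_{2,L}` inject into `W2.paramsB (L+2)` and the `α`-walks into `W2.paramsA (L+2)`, so
`B_{2,L}(x)`, `A_{2,L}(x)` are bounded ABOVE by the family partial sums, hence by their limits; with the lower
bounds of `HexSAWStripWidthTwo.lean` this gives the limits (§16).

## Main statements (namespace `Literature.Probability.RandomPlanarGeometry.SAW.HV`)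

* `HV.tendsto_stripB_two : Tendsto (fun L => stripB 2 L x) atTop (𝓝 (P_B x / Q x))` and `HV.tendsto_stripA_two`
  (`P_A/Q`), for `0 ≤ x < 1`, `x² + x³ < 1`; the uniform bounds `HV.stripB_two_le`, `HV.stripA_two_le`;
* `HV.stripB_two_unbounded : 1 ≤ x² + x³ → x ≤ 1 → ∀ C, ∃ L, C ≤ stripB 2 L x` — divergence at and above the
  strip's critical fugacity `x₂`, `x₂² + x₂³ = 1`, i.e. `x₂ = 1/ρ` with `ρ³ = ρ + 1` the PLASTIC NUMBER
  (`HV.stripTwo_critical_iff_plastic`); so the width-two bridge generating function has radius of convergence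
  exactly `1/ρ`, the pole `1 − x² − x³` of `Q`;
* in `HV.W2`: `exists_abs_of_mem`, `Shp`, `Shp.step`, `Shp.finish`, `shp_of_walk`, **`exists_param_of_mem`**
  (completeness), `stripB_two_le_sum`, `stripB_two_le_limB`, `tendsto_stripB_two_limB` (and the `A` twins),
  `stripB_two_ge_of_critical` (`B_{2,2N+2}(x) ≥ x⁴N` for `x² + x³ ≥ 1`, `x ≤ 1`).

Printed status (lane «pcv-sawmu», lead g7/g8 item (a′) «WIDTH-2 STRIP SOLVED», 2026-08-22): the two rational
functions are printed (unproved) in BGJ 2012 §2; a proof — here by an explicit classification of the strip's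
self-avoiding walks — was not found in print by the lane's literature seats. Together with
`HexSAWStripWidthTwo.lean` (`B₂(x_c) = (30√2−6)/49`) and `HexSAWStripWidthOne.lean` (`B₁`), the honeycomb strips
of widths one and two are now solved in the kernel.
-/

noncomputable section

open Finset Filter Topology

namespace Literature.Probability.RandomPlanarGeometry.SAW

namespace HV

namespace W2

/-! ### §11. From a mid-edge walk of `S_{2,L}` back to its abstract ladder list -/

/-- Abstract coordinates (rail, position) of a vertex of the width-two strip. [cite: DuminilCopinSmirnov2012, §3 (Fig. 3)] -/
def toAbs (v : HV) : Bool × ℤ := (decide (v.2.1 = 1), lpos v)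

/-- `ladV ∘ toAbs = id` on the strip (levels `0…3`). [cite: DuminilCopinSmirnov2012, §3 (Fig. 3)] -/
theorem ladV_toAbs {v : HV} (hv : v.2.1 = 0 ∨ v.2.1 = 1) : ladV (toAbs v) = v := by
  obtain ⟨a, b, c⟩ := v
  simp only at hv
  rcases hv with rfl | rfl <;> cases c
  · have h : (2 * a) % 2 = 0 := by omega
    have h' : (2 * a) / 2 = a := by omega
    simp [toAbs, ladV, lad, lpos, bit, h, h']
  · have h : (2 * a + 1) % 2 = 1 := by omega
    have h' : (2 * a + 1) / 2 = a := by omega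
    simp [toAbs, ladV, lad, lpos, bit, h, h']
  · have h : (2 * a + 1) % 2 = 1 := by omega
    have h' : (2 * a + 1) / 2 = a := by omega
    simp [toAbs, ladV, lad, lpos, bit, h, h']
  · have h : (2 * a + 2) % 2 = 0 := by omega
    have h' : (2 * a + 2) / 2 - 1 = a := by omega
    have e : 2 * a + 1 + 1 = 2 * a + 2 := by ring
    simp [toAbs, ladV, lad, lpos, bit, e, h, h']

/-- `toAbs ∘ ladV = id`. [cite: DuminilCopinSmirnov2012, §3 (Fig. 3)] -/
theorem toAbs_ladV (a : Bool × ℤ) : toAbs (ladV a) = a := by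
  obtain ⟨r, p⟩ := a
  cases r <;> simp [toAbs, ladV, lpos_lad, lad_snd_fst]

/-- Honeycomb adjacency between ladder vertices is ladder adjacency. [cite: DuminilCopinSmirnov2012, §3 (Fig. 3)] -/
theorem LAdj_of_adj {a b : Bool × ℤ} (h : hvGraph.Adj (ladV a) (ladV b)) : LAdj a b := by
  obtain ⟨r, p⟩ := a
  obtain ⟨r', q⟩ := b
  rw [hvGraph_adj] at h
  simp only [ladV] at h
  unfold lad AdjRel at h
  simp only [LAdj]
  rcases Int.emod_two_eq_zero_or_one p with hp | hp <;> rcases Int.emod_two_eq_zero_or_one q with hq | hq <;>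
    cases r <;> cases r' <;> simp [hp, hq] at h ⊢ <;> omega

/-- Strip vertices have second coordinate `0` or `1`. [cite: DuminilCopinSmirnov2012, §3 (the strip S_{T,L})] -/
theorem snd_of_mem_stripV_two {L : ℕ} {v : HV} (hv : v ∈ stripV 2 L) : v.2.1 = 0 ∨ v.2.1 = 1 := by
  rw [mem_stripV_iff] at hv
  obtain ⟨a, b, c⟩ := v
  simp only [lev_mk] at hv
  cases c <;> simp [bit] at hv ⊢ <;> omega

/-- Positions of strip vertices are bounded: `|p| ≤ 2L + 3`. [cite: DuminilCopinSmirnov2012, §3 (the strip S_{T,L})] -/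
theorem abs_lpos_of_mem_stripV_two {L : ℕ} {v : HV} (hv : v ∈ stripV 2 L) : |lpos v| ≤ 2 * (L : ℤ) + 3 := by
  rw [mem_stripV_iff] at hv
  obtain ⟨a, b, c⟩ := v
  simp only [lev_mk] at hv
  rw [abs_le]
  cases c <;> simp [bit, lpos] at hv ⊢ <;> omega

/-- **A `β`- or `α`-walk of `S_{2,L}` is the walk of its abstract ladder list**: `P = walkOfA A f e` with
`A = (inner P).map toAbs` an `LAdj`-chain from `(⊥, 0)` without repetition, positions `≤ 2L+3`, ending at
`(f, e)` with `e` even (`f = ⊤` for `β`, `f = ⊥` and `e ≠ 0` for `α`).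
[cite: DuminilCopinSmirnov2012, §3 (S_{T,L}, α, β)] -/
theorem exists_abs_of_mem {L : ℕ} {P : List HV} (hP : P ∈ midWalks (stripV 2 L))
    (hd : IsBetaDart 2 (finalDart P) ∨ IsAlphaDart (finalDart P)) :
    ∃ A : List (Bool × ℤ), ∃ f : Bool, ∃ e : ℤ,
      A.head? = some (false, 0) ∧ A.IsChain LAdj ∧ A.Nodup ∧ (∀ a ∈ A, |a.2| ≤ 2 * (L : ℤ) + 3) ∧
      A.getLast? = some (f, e) ∧ e % 2 = 0 ∧ (f = false → e ≠ 0) ∧ P = walkOfA A f e ∧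
      (IsBetaDart 2 (finalDart P) → f = true) ∧ (IsAlphaDart (finalDart P) → f = false) := by
  rw [mem_midWalks_iff] at hP
  obtain ⟨hch, hhead, hO, hV, hnd, hret⟩ := hP
  -- decompose `P = w :: T`, `T = Q ++ [u]`
  obtain ⟨T, rfl⟩ : ∃ T, P = wOut :: T := ⟨P.tail, List.eq_cons_of_mem_head? (by rw [hhead]; simp)⟩
  simp only [List.tail_cons] at hO
  have hTne : T ≠ [] := by rintro rfl; simp at hO
  obtain ⟨u, hu⟩ : ∃ u, T.getLast? = some u := by
    rcases List.getLast?_eq_none_iff.not.2 hTne |> Option.ne_none_iff_exists'.1 with ⟨u, hu⟩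
    exact ⟨u, hu⟩
  set Q := T.dropLast with hQ
  have hT : T = Q ++ [u] := by
    rw [hQ]; exact (List.dropLast_append_getLast? _ (Option.mem_def.2 hu)).symm
  have hinner : inner (wOut :: T) = Q := rfl
  rw [hinner] at hV hnd
  -- the final dart
  have hP_last : (wOut :: T).getLast? = some u := by rw [List.getLast?_cons_of_ne_nil hTne, hu]
  have hP_dl : (wOut :: T).dropLast = wOut :: Q := by rw [List.dropLast_cons_of_ne_nil hTne]
  -- `Q` is nonempty (else the final dart is `(w, O)`, neither `β` nor `α`)
  have hQne : Q ≠ [] := by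
    intro hQ0
    have hfd : finalDart (wOut :: T) = (wOut, u) := by
      rw [finalDart, hP_last, hP_dl, hQ0]; rfl
    rw [hfd] at hd
    rcases hd with h | h
    · exact absurd h.1 (by simp [wOut])
    · exact absurd h.1 (by simp [wOut])
  obtain ⟨v, hv⟩ : ∃ v, Q.getLast? = some v :=
    Option.ne_none_iff_exists'.1 (List.getLast?_eq_none_iff.not.2 hQne)
  have hfd : finalDart (wOut :: T) = (v, u) := by
    rw [finalDart, hP_last, hP_dl, List.getLast?_cons_of_ne_nil hQne, hv]; rfl
  rw [hfd] at hd
  -- `Q` starts at `O`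
  have hQhead : Q.head? = some hvOrigin := by
    rw [hT] at hO
    rwa [List.head?_append_of_ne_nil _ hQne] at hO
  -- the abstract list
  set A := Q.map toAbs with hA
  have hQV : ∀ x ∈ Q, x.2.1 = 0 ∨ x.2.1 = 1 := fun x hx => snd_of_mem_stripV_two (hV x hx)
  have hAQ : A.map ladV = Q := by
    rw [hA, List.map_map]
    conv_rhs => rw [← List.map_id Q]
    exact List.map_congr_left fun x hx => ladV_toAbs (hQV x hx)
  have hvV := hQV v (List.mem_of_mem_getLast? hv)
  -- exit data
  obtain ⟨f, e, hfe_def, he2, hfe0, hue, hβ, hα⟩ : ∃ f : Bool, ∃ e : ℤ, toAbs v = (f, e) ∧ e % 2 = 0 ∧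
      (f = false → e ≠ 0) ∧ u = exitOf f e ∧ (IsBetaDart 2 (v, u) → f = true) ∧ (IsAlphaDart (v, u) → f = false) := by
    rcases hd with h | h
    · obtain ⟨h1, h2, h3⟩ := h
      simp only at h1 h2 h3
      refine ⟨true, lpos v, ?_, ?_, by simp, ?_, fun _ => rfl, fun h' => ?_⟩
      · simp [toAbs, h1]
      · simp [lpos, h1, bit, h2]; omega
      · rw [h3, exitOf]
        obtain ⟨a, b, c⟩ := v
        simp only at h1 h2
        subst h1; subst h2
        simp [lpos, bit]; omega
      · exact absurd h'.1 (by rw [h1]; norm_num)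
    · obtain ⟨h1, h2, h3⟩ := h
      simp only at h1 h2 h3
      refine ⟨false, lpos v, ?_, ?_, fun _ => ?_, ?_, fun h' => ?_, fun _ => rfl⟩
      · simp [toAbs, h1]
      · simp [lpos, h1, bit, h2]
      · -- `e = 2 v.1 ≠ 0`: else `v = O` is both the first and the last inner vertex, so `Q = [O]` and the
        -- final half-edge is `a` reversed, which the mid-walk condition forbids
        intro he
        have hv1 : v.1 = 0 := by simp [lpos, h1, bit, h2] at he; omega
        have hvO : v = hvOrigin := by
          obtain ⟨a, b, c⟩ := v
          simp only at h1 h2 hv1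
          subst h1; subst h2; subst hv1; rfl
        -- `Q` nodup with head = last = O forces `Q = [O]`
        have hQ1 : Q = [hvOrigin] := by
          obtain ⟨x, Q', hQx⟩ := List.exists_cons_of_ne_nil hQne
          rw [hQx] at hQhead hnd hv
          simp only [List.head?_cons, Option.some.injEq] at hQhead
          subst hQhead
          rcases eq_or_ne Q' [] with hQ' | hQ'
          · rw [hQx, hQ']
          · exfalso
            rw [List.getLast?_cons_of_ne_nil hQ', hvO] at hv
            exact (List.nodup_cons.1 hnd).1 (List.mem_of_mem_getLast? hv)
        apply hret
        rw [hP_last, hP_dl, hQ1, h3, hvO]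
        rfl
      · rw [h3, exitOf]
        obtain ⟨a, b, c⟩ := v
        simp only at h1 h2
        subst h1; subst h2
        simp [lpos, bit]
      · exact absurd h'.1 (by rw [h1]; norm_num)
  refine ⟨A, f, e, ?_, ?_, ?_, ?_, ?_, he2, hfe0, ?_, fun h => hβ (by rwa [hfd] at h), fun h => hα (by rwa [hfd] at h)⟩
  · rw [hA, List.head?_map, hQhead]; simp [toAbs, hvOrigin, lpos, bit]
  · -- chain
    have hTc : T.IsChain hvGraph.Adj := by
      have := hch; rw [List.isChain_cons] at this; exact this.2
    rw [hT, List.isChain_append] at hTc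
    have hQc := hTc.1
    rw [← hAQ, List.isChain_map] at hQc
    exact hQc.imp fun a b h => LAdj_of_adj h
  · -- nodup
    rw [hA]
    refine hnd.map_on fun x hx y hy hxy => ?_
    rw [← ladV_toAbs (hQV x hx), ← ladV_toAbs (hQV y hy), hxy]
  · intro a ha
    rw [hA, List.mem_map] at ha
    obtain ⟨x, hx, rfl⟩ := ha
    exact abs_lpos_of_mem_stripV_two (hV x hx)
  · rw [hA, List.getLast?_map, hv, Option.map_some, hfe_def]
  · rw [walkOfA, hAQ, ← hue, ← hT]



/-! ### §12. Shapes of the prefixes of a ladder walk -/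

/-- An ascending run of `n` vertices on rail `c` after position `q`: `(c, q+1), …, (c, q+n)`.
[cite: DuminilCopinSmirnov2012, §3 (Fig. 3)] -/
def run (c : Bool) (q : ℤ) (n : ℕ) : List (Bool × ℤ) := (List.range n).map fun i : ℕ => (c, q + 1 + i)

/-- A descending run on rail `r` from position `E` down to `j`: `(r, E), (r, E−1), …, (r, j)`.
[cite: DuminilCopinSmirnov2012, §3 (Fig. 3)] -/
def downrun (r : Bool) (E j : ℤ) : List (Bool × ℤ) := (List.range (E - j + 1).toNat).map fun i : ℕ => (r, E - i)

/-- A partial weave block after position `e` on rail `c`: nothing, the entry `(c, e+1)`, or the entry and the rung.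
[cite: DuminilCopinSmirnov2012, §3 (Fig. 3)] -/
def pblock (c : Bool) (e : ℤ) : ℕ → List (Bool × ℤ)
  | 0 => []
  | 1 => [(c, e + 1)]
  | _ => [(c, e + 1), (!c, e + 1)]

/-- Shape T3: prefix, weave, partial block (the walk is weaving). [cite: DuminilCopinSmirnov2012, §3 (Fig. 3)] -/
def shapeT3 (left : Option ℕ) (l : List Bool) (k : ℕ) : List (Bool × ℤ) :=
  pre left ++ weave left.isSome 0 l ++ pblock (wend left.isSome l) (2 * (l.length : ℤ)) k

/-- Shape T4: prefix, weave `l` followed by `n` straight blocks, the turning rung, and the return run down to `j`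
(the walk is in its final, trapped, right excursion). [cite: DuminilCopinSmirnov2012, §3 (Fig. 3)] -/
def shapeT4 (left : Option ℕ) (l : List Bool) (n : ℕ) (j : ℤ) : List (Bool × ℤ) :=
  pre left ++ weave left.isSome 0 (l ++ List.replicate n (wend left.isSome l)) ++
    [(wend left.isSome l, 2 * ((l.length : ℤ) + n) + 1), (!wend left.isSome l, 2 * ((l.length : ℤ) + n) + 1)] ++
    downrun (!wend left.isSome l) (2 * ((l.length : ℤ) + n)) j

/-- The admissible shapes of a prefix (normalised to the right side). [cite: DuminilCopinSmirnov2012, §3 (Fig. 3)] -/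
def Shp (X : List (Bool × ℤ)) : Prop :=
  (∃ left l k, k ≤ 2 ∧ X = shapeT3 left l k) ∨
  (∃ (left : Option ℕ) (l : List Bool) (n : ℕ) (j : ℤ),
    2 * (l.length : ℤ) ≤ j ∧ (l = [] → 1 ≤ j) ∧ j ≤ 2 * ((l.length : ℤ) + (n : ℤ)) ∧ X = shapeT4 left l n j)

/-! #### List identities for runs, weaves and excursions -/

/-- Helper `run_zero` for the width-two classification. [folklore] -/
private theorem run_zero (c : Bool) (q : ℤ) : run c q 0 = [] := rfl

/-- Helper `run_succ` for the width-two classification. [folklore] -/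
private theorem run_succ (c : Bool) (q : ℤ) (n : ℕ) : run c q (n + 1) = run c q n ++ [(c, q + 1 + n)] := by
  rw [run, List.range_succ, List.map_append, List.map_singleton]; rfl

/-- Helper `run_succ'` for the width-two classification. [folklore] -/
private theorem run_succ' (c : Bool) (q : ℤ) (n : ℕ) : run c q (n + 1) = (c, q + 1) :: run c (q + 1) n := by
  rw [run, List.range_succ_eq_map, List.map_cons, List.map_map, run]
  simp only [Nat.cast_zero, add_zero, List.cons.injEq, true_and]
  refine List.map_congr_left fun i _ => ?_
  simp only [Function.comp_apply, Nat.cast_succ, Prod.mk.injEq, true_and]; ring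

/-- Helper `mem_run` for the width-two classification. [folklore] -/
private theorem mem_run {c : Bool} {q : ℤ} {n : ℕ} {a : Bool × ℤ} : a ∈ run c q n ↔ a.1 = c ∧ q + 1 ≤ a.2 ∧ a.2 ≤ q + n := by
  simp only [run, List.mem_map, List.mem_range]
  constructor
  · rintro ⟨i, hi, rfl⟩; refine ⟨rfl, ?_, ?_⟩ <;> push_cast <;> omega
  · rintro ⟨h1, h2, h3⟩
    refine ⟨(a.2 - q - 1).toNat, by omega, ?_⟩
    ext <;> simp [h1]; omega

/-- Helper `weave_append` for the width-two classification. [folklore] -/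
private theorem weave_append (r : Bool) (p : ℤ) (l₁ l₂ : List Bool) :
    weave r p (l₁ ++ l₂) = weave r p l₁ ++ weave (wend r l₁) (p + 2 * (l₁.length : ℤ)) l₂ := by
  induction l₁ generalizing r p with
  | nil => simp [weave, wend]
  | cons b l ih =>
    rw [List.cons_append, weave, weave, ih, List.append_assoc]
    simp only [wend, List.length_cons]
    push_cast; ring_nf

/-- Helper `wend_append` for the width-two classification. [folklore] -/
private theorem wend_append (r : Bool) (l₁ l₂ : List Bool) : wend r (l₁ ++ l₂) = wend (wend r l₁) l₂ := by
  induction l₁ generalizing r with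
  | nil => rfl
  | cons b l ih => exact ih b

/-- Helper `wend_replicate` for the width-two classification. [folklore] -/
private theorem wend_replicate (c : Bool) (n : ℕ) : wend c (List.replicate n c) = c := by
  induction n with
  | zero => rfl
  | succ n ih => rw [List.replicate_succ]; exact ih

/-- Helper `weave_replicate` for the width-two classification. [folklore] -/
private theorem weave_replicate (c : Bool) (p : ℤ) (n : ℕ) : weave c p (List.replicate n c) = run c p (2 * n) := by
  induction n generalizing p with
  | zero => rfl
  | succ n ih =>
    rw [List.replicate_succ, weave, ih, block, if_pos rfl, show 2 * (n + 1) = (2 * n + 1) + 1 by ring,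
      run_succ', run_succ']
    simp only [List.cons_append, List.nil_append, List.cons.injEq, true_and]
    constructor
    · simp only [Prod.mk.injEq, true_and]; ring
    · congr 1; ring

/-- Helper `wlen_append` for the width-two classification. [folklore] -/
private theorem wlen_append (r : Bool) (l₁ l₂ : List Bool) : wlen r (l₁ ++ l₂) = wlen r l₁ + wlen (wend r l₁) l₂ := by
  induction l₁ generalizing r with
  | nil => simp [wlen, wend]
  | cons b l ih => simp [wlen, wend, ih, Nat.add_assoc]

/-- Helper `downrun_self` for the width-two classification. [folklore] -/
private theorem downrun_self (r : Bool) (E : ℤ) : downrun r E E = [(r, E)] := by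
  simp [downrun]

/-- Helper `downrun_pred` for the width-two classification. [folklore] -/
private theorem downrun_pred {r : Bool} {E j : ℤ} (h : j ≤ E) : downrun r E (j - 1) = downrun r E j ++ [(r, j - 1)] := by
  rw [downrun, downrun, show (E - (j - 1) + 1).toNat = (E - j + 1).toNat + 1 by omega, List.range_succ,
    List.map_append, List.map_singleton]
  congr 2
  simp only [Prod.mk.injEq, true_and]
  omega

/-- Helper `downrun_succ_top` for the width-two classification. [folklore] -/
private theorem downrun_succ_top {r : Bool} {E j : ℤ} (h : j ≤ E + 1) : downrun r (E + 1) j = (r, E + 1) :: downrun r E j := by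
  rw [downrun, downrun, show (E + 1 - j + 1).toNat = (E - j + 1).toNat + 1 by omega, List.range_succ_eq_map,
    List.map_cons, List.map_map]
  simp only [Nat.cast_zero, sub_zero, List.cons.injEq, true_and]
  refine List.map_congr_left fun i _ => ?_
  simp only [Function.comp_apply, Nat.cast_succ, Prod.mk.injEq, true_and]; ring

/-- Helper `mem_downrun` for the width-two classification. [folklore] -/
private theorem mem_downrun {r : Bool} {E j : ℤ} (h : j ≤ E) {a : Bool × ℤ} : a ∈ downrun r E j ↔ a.1 = r ∧ j ≤ a.2 ∧ a.2 ≤ E := by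
  simp only [downrun, List.mem_map, List.mem_range]
  constructor
  · rintro ⟨i, hi, rfl⟩; refine ⟨rfl, ?_, ?_⟩ <;> omega
  · rintro ⟨h1, h2, h3⟩
    refine ⟨(E - a.2).toNat, by omega, ?_⟩
    ext <;> simp [h1]; omega

/-- Helper `getLast?_downrun` for the width-two classification. [folklore] -/
private theorem getLast?_downrun {r : Bool} {E j : ℤ} (h : j ≤ E) : (downrun r E j).getLast? = some (r, j) := by
  rw [downrun, List.getLast?_map, List.getLast?_eq_getElem?, List.length_range,
    List.getElem?_range (by omega)]
  simp only [Option.map_some, Option.some.injEq, Prod.mk.injEq, true_and]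
  omega

/-- Helper `downrun_ne_nil` for the width-two classification. [folklore] -/
private theorem downrun_ne_nil {r : Bool} {E j : ℤ} (h : j ≤ E) : downrun r E j ≠ [] := by
  intro h0; have := congrArg List.length h0; simp [downrun] at this; omega

/-- Helper `excR_eq_run_downrun` for the width-two classification. [folklore] -/
private theorem excR_eq_run_downrun (c : Bool) (e : ℤ) (k : ℕ) :
    excR c e k = run c e (2 * k + 1) ++ downrun (!c) (e + (2 * k + 1)) e := by
  rw [excR, run, downrun]
  congr 1
  rw [show (e + (2 * (k : ℤ) + 1) - e + 1).toNat = 2 * k + 2 by omega]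

/-! #### Last entries and members of the shapes -/

/-- Helper `getLast?_shapeT3_zero` for the width-two classification. [folklore] -/
private theorem getLast?_shapeT3_zero (left : Option ℕ) (l : List Bool) :
    (shapeT3 left l 0).getLast? = some (wend left.isSome l, 2 * (l.length : ℤ)) := by
  simpa [shapeT3, pblock] using getLast?_pre_weave left l

/-- Helper `getLast?_shapeT3_one` for the width-two classification. [folklore] -/
private theorem getLast?_shapeT3_one (left : Option ℕ) (l : List Bool) :
    (shapeT3 left l 1).getLast? = some (wend left.isSome l, 2 * (l.length : ℤ) + 1) := by
  simp [shapeT3, pblock]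

/-- Helper `getLast?_shapeT3_two` for the width-two classification. [folklore] -/
private theorem getLast?_shapeT3_two (left : Option ℕ) (l : List Bool) :
    (shapeT3 left l 2).getLast? = some (!wend left.isSome l, 2 * (l.length : ℤ) + 1) := by
  simp [shapeT3, pblock]

/-- Helper `getLast?_shapeT4` for the width-two classification. [folklore] -/
private theorem getLast?_shapeT4 (left : Option ℕ) (l : List Bool) (n : ℕ) {j : ℤ} (hj : j ≤ 2 * ((l.length : ℤ) + n)) :
    (shapeT4 left l n j).getLast? = some (!wend left.isSome l, j) := by
  rw [shapeT4, List.getLast?_append, getLast?_downrun hj]; simp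

/-- The vertices of shape T3. [cite: DuminilCopinSmirnov2012, §3 (Fig. 3)] -/
theorem mem_shapeT3_iff {left : Option ℕ} {l : List Bool} {k : ℕ} {a : Bool × ℤ} :
    a ∈ shapeT3 left l k ↔ a ∈ pre left ++ weave left.isSome 0 l ∨ a ∈ pblock (wend left.isSome l) (2 * (l.length : ℤ)) k := by
  rw [shapeT3, List.mem_append]

/-- The straight part and the turn of shape T4. [cite: DuminilCopinSmirnov2012, §3 (Fig. 3)] -/
theorem shapeT4_eq (left : Option ℕ) (l : List Bool) (n : ℕ) {j : ℤ} (hj : j ≤ 2 * ((l.length : ℤ) + n) + 1) :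
    shapeT4 left l n j = (pre left ++ weave left.isSome 0 l) ++
      (run (wend left.isSome l) (2 * (l.length : ℤ)) (2 * n + 1) ++
        downrun (!wend left.isSome l) (2 * ((l.length : ℤ) + n) + 1) j) := by
  have e1 : (2 * (l.length : ℤ) + 1 + ((2 * n : ℕ) : ℤ)) = 2 * ((l.length : ℤ) + n) + 1 := by push_cast; ring
  rw [shapeT4, weave_append, weave_replicate, run_succ, downrun_succ_top hj, e1, zero_add]
  simp only [List.append_assoc, List.cons_append, List.nil_append]

/-! #### Transition identities and obstruction members -/

/-- Helper `map_smap_one` for the width-two classification. [folklore] -/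
private theorem map_smap_one (X : List (Bool × ℤ)) : X.map (smap 1) = X := by
  induction X with
  | nil => rfl
  | cons a X ih => simp [smap, ih]

/-- Helper `smap_smap` for the width-two classification. [folklore] -/
private theorem smap_smap {s : ℤ} (hs : s = 1 ∨ s = -1) (a : Bool × ℤ) : smap s (smap s a) = a := by
  obtain ⟨r, p⟩ := a
  rcases hs with rfl | rfl <;> simp [smap]

/-- Helper `map_smap_smap` for the width-two classification. [folklore] -/
private theorem map_smap_smap {s : ℤ} (hs : s = 1 ∨ s = -1) (X : List (Bool × ℤ)) : (X.map (smap s)).map (smap s) = X := by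
  rw [List.map_map]
  conv_rhs => rw [← List.map_id X]
  exact List.map_congr_left fun a _ => smap_smap hs a

/-- Helper `smap_mul` for the width-two classification. [folklore] -/
private theorem smap_mul (s t : ℤ) (a : Bool × ℤ) : smap s (smap t a) = smap (s * t) a := by
  simp [smap, mul_comm, mul_left_comm]

/-- (E1) [folklore] -/
private theorem T3_zero_step (left : Option ℕ) (l : List Bool) :
    shapeT3 left l 0 ++ [(wend left.isSome l, 2 * (l.length : ℤ) + 1)] = shapeT3 left l 1 := by
  simp [shapeT3, pblock]

/-- (E2) [folklore] -/
private theorem T3_one_step (left : Option ℕ) (l : List Bool) :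
    shapeT3 left l 1 ++ [(wend left.isSome l, 2 * (l.length : ℤ) + 2)] = shapeT3 left (l ++ [wend left.isSome l]) 0 := by
  rw [shapeT3, shapeT3, weave_append]
  simp only [weave, block, pblock, List.append_nil, List.append_assoc,
    List.cons_append, List.nil_append, zero_add]
  rfl

/-- (E3) [folklore] -/
private theorem T3_one_rung (left : Option ℕ) (l : List Bool) :
    shapeT3 left l 1 ++ [(!wend left.isSome l, 2 * (l.length : ℤ) + 1)] = shapeT3 left l 2 := by
  simp [shapeT3, pblock]

/-- (E4) [folklore] -/
private theorem T3_two_step (left : Option ℕ) (l : List Bool) :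
    shapeT3 left l 2 ++ [(!wend left.isSome l, 2 * (l.length : ℤ) + 2)] = shapeT3 left (l ++ [!wend left.isSome l]) 0 := by
  rw [shapeT3, shapeT3, weave_append]
  have h : (!wend left.isSome l) ≠ wend left.isSome l := by cases wend left.isSome l <;> decide
  simp only [weave, block, if_neg h, pblock, List.append_nil, List.append_assoc, List.cons_append,
    List.nil_append, zero_add]

/-- (E5) [folklore] -/
private theorem T3_two_turn (left : Option ℕ) (l : List Bool) :
    shapeT3 left l 2 ++ [(!wend left.isSome l, 2 * (l.length : ℤ))] = shapeT4 left l 0 (2 * (l.length : ℤ)) := by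
  simp [shapeT3, shapeT4, pblock, downrun_self]

/-- (E10) [folklore] -/
private theorem T4_down (left : Option ℕ) (l : List Bool) (n : ℕ) {j : ℤ} (hj : j ≤ 2 * ((l.length : ℤ) + n)) :
    shapeT4 left l n j ++ [(!wend left.isSome l, j - 1)] = shapeT4 left l n (j - 1) := by
  rw [shapeT4, shapeT4, List.append_assoc, ← downrun_pred hj]

/-- (E11) [folklore] -/
private theorem T4_shift (left : Option ℕ) (l : List Bool) (n : ℕ) (j : ℤ) :
    shapeT4 left (l ++ [wend left.isSome l]) n j = shapeT4 left l (n + 1) j := by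
  simp only [shapeT4, wend_append, wend, List.append_assoc, List.singleton_append, ← List.replicate_succ,
    List.length_append, List.length_singleton]
  push_cast
  ring_nf

/-- The mirrored left excursion is the origin's run to the right and back on top. [folklore] -/
private theorem map_smap_neg_excL (k : ℕ) :
    (excL k).map (smap (-1)) = run false 0 (2 * k + 1) ++ downrun true (2 * k + 1) 0 := by
  rw [excL, List.map_append, run, downrun, List.map_map, List.map_map,
    show ((2 * (k : ℤ) + 1) - 0 + 1).toNat = 2 * k + 2 by omega]
  congr 1
  · refine List.map_congr_left fun i _ => ?_
    simp [smap]; ring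
  · refine List.map_congr_left fun i _ => ?_
    simp [smap]

/-- (E9) the walks exiting straight above `a`: `pre (some k)` mirrored is `encode none [] (some k)`. [folklore] -/
private theorem map_smap_neg_pre_some (k : ℕ) :
    (pre (some k)).map (smap (-1)) = encode none [] (some k) := by
  rw [pre, Option.elim_some, List.map_cons, map_smap_neg_excL, encode]
  simp only [pre, Option.elim_none, Option.isSome_none, weave, List.append_nil, Option.elim_some, wend,
    List.length_nil, Nat.cast_zero, mul_zero, excR_eq_run_downrun, zero_add, Bool.not_false,
    List.singleton_append]
  simp [smap]

/-- (E7) [folklore] -/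
private theorem T3_flip_turn : shapeT3 none [] 2 ++ [(true, 0)] = (shapeT3 (some 0) [] 0).map (smap (-1)) := by
  simp [shapeT3, pre, excL, weave, pblock, smap, wend, List.range_succ]

/-- (E6) [folklore] -/
private theorem T3_flip_first : shapeT3 none [] 0 ++ [(false, -1)] = (shapeT3 none [] 1).map (smap (-1)) := by
  simp [shapeT3, pre, weave, pblock, smap, wend]

/-- (E8) [folklore] -/
private theorem T4_flip (n : ℕ) : shapeT4 none [] n 1 ++ [(true, 0)] = (shapeT3 (some n) [] 0).map (smap (-1)) := by
  have hd : downrun true (2 * (n : ℤ) + 1) 1 ++ [(true, 0)] = downrun true (2 * (n : ℤ) + 1) 0 := by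
    have := downrun_pred (r := true) (E := 2 * (n : ℤ) + 1) (j := 1) (by omega)
    rw [sub_self] at this; exact this.symm
  rw [shapeT4_eq _ _ _ (by omega), shapeT3]
  simp only [pre, Option.elim_none, Option.isSome_none, weave, List.append_nil, wend, List.length_nil,
    Nat.cast_zero, mul_zero, zero_add, Bool.not_false, pblock, Option.elim_some,
    List.map_cons, List.cons_append, List.append_assoc, List.nil_append]
  rw [map_smap_neg_excL, hd]
  simp [smap]

/-- (M1) the penultimate position of a nonempty weave is on the final rail. [folklore] -/
private theorem mem_weave_pred {l : List Bool} (hl : l ≠ []) (r : Bool) (p : ℤ) :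
    (wend r l, p + 2 * (l.length : ℤ) - 1) ∈ weave r p l := by
  obtain ⟨l', b, rfl⟩ : ∃ l' b, l = l' ++ [b] := ⟨l.dropLast, l.getLast hl, (List.dropLast_append_getLast hl).symm⟩
  rw [weave_append, wend_append, List.mem_append]
  right
  simp only [weave, wend, List.append_nil, List.length_append, List.length_singleton, block]
  split_ifs with h
  · subst h; simp; left; ring
  · simp; right; left; ring

/-- (M2) after a left excursion `(⊤, -1)` is used. [folklore] -/
private theorem mem_pre_top_neg_one (k : ℕ) : (true, -1) ∈ pre (some k) := by
  simp only [pre, Option.elim_some, List.mem_cons, excL, List.mem_append, List.mem_map, List.mem_range]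
  right; right
  exact ⟨2 * k, by omega, by simp only [Prod.mk.injEq, true_and]; push_cast; ring⟩

/-- (M3) the origin is in the prefix. [folklore] -/
private theorem mem_pre_origin (left : Option ℕ) : (false, 0) ∈ pre left := by
  simp [pre]

/-- (M8) the last switch blocks the return: if the last block of `l ++ [b]` switches, its entry vertex is
`(!b, 2|l|+1)`. [folklore] -/
private theorem mem_weave_switch (r : Bool) (p : ℤ) (l : List Bool) {b : Bool} (hb : b ≠ wend r l) :
    (!b, p + 2 * (l.length : ℤ) + 1) ∈ weave r p (l ++ [b]) := by
  rw [weave_append, List.mem_append]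
  right
  have : wend r l = !b := by
    rcases Bool.eq_false_or_eq_true (wend r l) with h | h <;>
      rcases Bool.eq_false_or_eq_true b with h' | h' <;> simp_all
  simp [weave, block, this]


/-! #### Membership in the shapes -/

/-- Helper `mem_T3_of_mem_pre` for the width-two classification. [folklore] -/
private theorem mem_T3_of_mem_pre {left : Option ℕ} {l : List Bool} {k : ℕ} {a : Bool × ℤ} (h : a ∈ pre left) :
    a ∈ shapeT3 left l k := by
  rw [shapeT3, List.append_assoc, List.mem_append]; exact Or.inl h

/-- Helper `mem_T3_of_mem_weave` for the width-two classification. [folklore] -/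
private theorem mem_T3_of_mem_weave {left : Option ℕ} {l : List Bool} {k : ℕ} {a : Bool × ℤ}
    (h : a ∈ weave left.isSome 0 l) : a ∈ shapeT3 left l k := by
  rw [shapeT3, List.append_assoc, List.mem_append, List.mem_append]; exact Or.inr (Or.inl h)

/-- Helper `mem_T3_of_mem_pblock` for the width-two classification. [folklore] -/
private theorem mem_T3_of_mem_pblock {left : Option ℕ} {l : List Bool} {k : ℕ} {a : Bool × ℤ}
    (h : a ∈ pblock (wend left.isSome l) (2 * (l.length : ℤ)) k) : a ∈ shapeT3 left l k := by
  rw [shapeT3, List.mem_append]; exact Or.inr h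

/-- Helper `mem_T4_of_mem_pre` for the width-two classification. [folklore] -/
private theorem mem_T4_of_mem_pre {left : Option ℕ} {l : List Bool} {n : ℕ} {j : ℤ} {a : Bool × ℤ} (h : a ∈ pre left) :
    a ∈ shapeT4 left l n j := by
  simp only [shapeT4, List.append_assoc, List.mem_append]; exact Or.inl h

/-- Helper `mem_T4_of_mem_weave` for the width-two classification. [folklore] -/
private theorem mem_T4_of_mem_weave {left : Option ℕ} {l : List Bool} {n : ℕ} {j : ℤ} {a : Bool × ℤ}
    (h : a ∈ weave left.isSome 0 l) : a ∈ shapeT4 left l n j := by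
  simp only [shapeT4, weave_append, List.append_assoc, List.mem_append]; exact Or.inr (Or.inl h)

/-- Helper `mem_T4_of_mem_run` for the width-two classification. [folklore] -/
private theorem mem_T4_of_mem_run {left : Option ℕ} {l : List Bool} {n : ℕ} {j : ℤ} (hj : j ≤ 2 * ((l.length : ℤ) + n) + 1)
    {a : Bool × ℤ} (h : a ∈ run (wend left.isSome l) (2 * (l.length : ℤ)) (2 * n + 1)) : a ∈ shapeT4 left l n j := by
  rw [shapeT4_eq _ _ _ hj]; simp only [List.append_assoc, List.mem_append]; exact Or.inr (Or.inr (Or.inl h))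

/-- Helper `mem_T4_of_mem_downrun` for the width-two classification. [folklore] -/
private theorem mem_T4_of_mem_downrun {left : Option ℕ} {l : List Bool} {n : ℕ} {j : ℤ} (hj : j ≤ 2 * ((l.length : ℤ) + n) + 1)
    {a : Bool × ℤ} (h : a ∈ downrun (!wend left.isSome l) (2 * ((l.length : ℤ) + n) + 1) j) :
    a ∈ shapeT4 left l n j := by
  rw [shapeT4_eq _ _ _ hj]; simp only [List.append_assoc, List.mem_append]; exact Or.inr (Or.inr (Or.inr h))

/-! #### The step -/

/-- **One step of a self-avoiding ladder walk preserves the shape, up to the mirror.**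
[cite: DuminilCopinSmirnov2012, §3 (Fig. 3)] -/
theorem Shp.step {X : List (Bool × ℤ)} (hX : Shp X) {a v : Bool × ℤ} (ha : X.getLast? = some a)
    (hav : LAdj a v) (hv : v ∉ X) :
    ∃ s : ℤ, (s = 1 ∨ s = -1) ∧ ∃ X', Shp X' ∧ X ++ [v] = X'.map (smap s) := by
  obtain ⟨v1, v2⟩ := v
  have fin : ∀ X', Shp X' → X ++ [(v1, v2)] = X' →
      ∃ s : ℤ, (s = 1 ∨ s = -1) ∧ ∃ X', Shp X' ∧ X ++ [(v1, v2)] = X'.map (smap s) :=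
    fun X' h1 h2 => ⟨1, Or.inl rfl, X', h1, by rw [map_smap_one]; exact h2⟩
  have finm : ∀ X', Shp X' → X ++ [(v1, v2)] = X'.map (smap (-1)) →
      ∃ s : ℤ, (s = 1 ∨ s = -1) ∧ ∃ X', Shp X' ∧ X ++ [(v1, v2)] = X'.map (smap s) :=
    fun X' h1 h2 => ⟨-1, Or.inr rfl, X', h1, h2⟩
  rcases hX with ⟨left, l, k, hk, rfl⟩ | ⟨left, l, n, j, hj1, hj2, hj3, rfl⟩
  · -- shape T3
    rcases (by omega : k = 0 ∨ k = 1 ∨ k = 2) with rfl | rfl | rfl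
    · -- k = 0: the walk stands at the end `(c, e)` of a block (or at the origin / after the left excursion)
      rw [getLast?_shapeT3_zero, Option.some.injEq] at ha
      subst ha
      simp only [LAdj] at hav
      rcases hav with ⟨h1, h2 | h2⟩ | ⟨h1, h2, h3⟩
      · subst h1; subst h2
        exact fin _ (Or.inl ⟨left, l, 1, by norm_num, rfl⟩) (T3_zero_step left l)
      · subst h1; subst h2
        rcases eq_or_ne l [] with rfl | hl
        · cases left with
          | some kk =>
            exfalso; apply hv
            exact mem_T3_of_mem_pre (by simpa [wend] using mem_pre_top_neg_one kk)
          | none =>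
            refine finm (shapeT3 none [] 1) (Or.inl ⟨none, [], 1, by norm_num, rfl⟩) ?_
            simpa [wend] using T3_flip_first
        · exfalso; apply hv
          exact mem_T3_of_mem_weave (by simpa using mem_weave_pred hl left.isSome 0)
      · exfalso; omega
    · -- k = 1: the walk stands at the odd position `(c, e+1)`
      rw [getLast?_shapeT3_one, Option.some.injEq] at ha
      subst ha
      simp only [LAdj] at hav
      rcases hav with ⟨h1, h2 | h2⟩ | ⟨h1, h2, h3⟩
      · subst h1
        rw [show (2 * (l.length : ℤ) + 1 + 1) = 2 * (l.length : ℤ) + 2 by ring] at h2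
        subst h2
        exact fin _ (Or.inl ⟨left, l ++ [wend left.isSome l], 0, by norm_num, rfl⟩) (T3_one_step left l)
      · subst h1; subst h2
        exfalso; apply hv
        have hm := List.mem_of_mem_getLast? (getLast?_pre_weave left l)
        rw [show (2 * (l.length : ℤ) + 1 - 1) = 2 * (l.length : ℤ) by ring]
        rw [shapeT3, List.mem_append]; exact Or.inl hm
      · subst h1; subst h2
        exact fin _ (Or.inl ⟨left, l, 2, le_rfl, rfl⟩) (T3_one_rung left l)
    · -- k = 2: the walk has taken the rung at `e+1`
      rw [getLast?_shapeT3_two, Option.some.injEq] at ha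
      subst ha
      simp only [LAdj, Bool.not_not] at hav
      rcases hav with ⟨h1, h2 | h2⟩ | ⟨h1, h2, h3⟩
      · subst h1
        rw [show (2 * (l.length : ℤ) + 1 + 1) = 2 * (l.length : ℤ) + 2 by ring] at h2
        subst h2
        exact fin _ (Or.inl ⟨left, l ++ [!wend left.isSome l], 0, by norm_num, rfl⟩) (T3_two_step left l)
      · subst h1
        rw [show (2 * (l.length : ℤ) + 1 - 1) = 2 * (l.length : ℤ) by ring] at h2
        subst h2
        rcases eq_or_ne l [] with rfl | hl
        · cases left with
          | some kk =>
            exfalso; apply hv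
            exact mem_T3_of_mem_pre (by simpa [wend] using mem_pre_origin (some kk))
          | none =>
            refine finm (shapeT3 (some 0) [] 0) (Or.inl ⟨some 0, [], 0, by norm_num, rfl⟩) ?_
            simpa [wend] using T3_flip_turn
        · exact fin (shapeT4 left l 0 (2 * (l.length : ℤ))) (Or.inr ⟨left, l, 0, _, le_rfl, fun h => absurd h hl,
            by push_cast; omega, rfl⟩) (T3_two_turn left l)
      · subst h1; subst h2
        exfalso; apply hv
        exact mem_T3_of_mem_pblock (by simp [pblock])
  · -- shape T4: the walk is on its return run at `(!c, j)`
    rw [getLast?_shapeT4 _ _ _ hj3] at ha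
    simp only [Option.some.injEq] at ha
    subst ha
    simp only [LAdj, Bool.not_not] at hav
    rcases hav with ⟨h1, h2 | h2⟩ | ⟨h1, h2, h3⟩
    · -- forward: back up the return run
      subst h1; subst h2
      exfalso; apply hv
      exact mem_T4_of_mem_downrun (by omega) ((mem_downrun (by omega)).2 ⟨rfl, by omega, by omega⟩)
    · -- down the return run
      subst h1; subst h2
      by_cases hA : 2 * (l.length : ℤ) ≤ j - 1
      · by_cases hB : l = [] → 1 ≤ j - 1
        · exact fin _ (Or.inr ⟨left, l, n, j - 1, hA, hB, by omega, rfl⟩) (T4_down left l n hj3)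
        · have hl : l = [] := by by_contra h; exact hB fun h' => absurd h' h
          subst hl
          have hj : j = 1 := by simp at hj2 hB; omega
          subst hj
          cases left with
          | some kk =>
            exfalso; apply hv
            exact mem_T4_of_mem_pre (by simpa [wend] using mem_pre_origin (some kk))
          | none =>
            refine finm (shapeT3 (some n) [] 0) (Or.inl ⟨some n, [], 0, by norm_num, rfl⟩) ?_
            simpa [wend] using T4_flip n
      · have hj : j = 2 * (l.length : ℤ) := by omega
        subst hj
        have hl : l ≠ [] := by rintro rfl; simp at hj2
        obtain ⟨l', b, rfl⟩ : ∃ l' b, l = l' ++ [b] := ⟨l.dropLast, l.getLast hl, (List.dropLast_append_getLast hl).symm⟩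
        by_cases hb : b = wend left.isSome l'
        · subst hb
          refine ⟨1, Or.inl rfl, shapeT4 left l' (n + 1) (2 * ((l' ++ [wend left.isSome l']).length : ℤ) - 1),
            Or.inr ⟨left, l', n + 1, _, by simp, fun _ => by simp; omega,
              by simp only [List.length_append, List.length_singleton]; push_cast; omega, rfl⟩, ?_⟩
          rw [map_smap_one, T4_shift, ← T4_down left l' (n + 1)
            (by simp only [List.length_append, List.length_singleton]; push_cast; omega), wend_append]
          rfl
        · exfalso; apply hv
          apply mem_T4_of_mem_weave
          have := mem_weave_switch left.isSome 0 l' hb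
          rw [wend_append]
          simp only [wend, List.length_append, List.length_singleton] at this ⊢
          convert this using 2
          push_cast; ring
    · -- rung: lands on the straight part
      subst h1; subst h2
      exfalso; apply hv
      exact mem_T4_of_mem_run (by omega) (mem_run.2 ⟨rfl, by omega, by push_cast; omega⟩)


/-! ### §13. The end of the walk: every complete shape is an encoded family walk -/

/-- Helper `run_append` for the width-two classification. [folklore] -/
private theorem run_append (c : Bool) (q : ℤ) (m m' : ℕ) : run c q m ++ run c (q + m) m' = run c q (m + m') := by
  rw [run, run, run, List.range_add, List.map_append, List.map_map]
  congr 1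
  refine List.map_congr_left fun i _ => ?_
  simp only [Function.comp_apply, Nat.cast_add, Prod.mk.injEq, true_and]; ring

/-- A complete T4 shape, stopped at the even position `2|l| + 2t` of its return run, is the encoded walk with
weave `l ++ cᵗ` and a right excursion of depth `2(n−t)+1`. [cite: DuminilCopinSmirnov2012, §3 (Fig. 3)] -/
theorem shapeT4_eq_encode (left : Option ℕ) (l : List Bool) (n t : ℕ) (htn : t ≤ n) :
    shapeT4 left l n (2 * (l.length : ℤ) + 2 * t) =
      encode left (l ++ List.replicate t (wend left.isSome l)) (some (n - t)) := by
  rw [shapeT4_eq _ _ _ (by omega), encode, Option.elim_some, wend_append, wend_replicate, weave_append,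
    weave_replicate, excR_eq_run_downrun, List.length_append, List.length_replicate]
  have e1 : (0 : ℤ) + 2 * (l.length : ℤ) = 2 * (l.length : ℤ) := by ring
  have e3 : 2 * ((l.length + t : ℕ) : ℤ) + (2 * ((n - t : ℕ) : ℤ) + 1) = 2 * ((l.length : ℤ) + n) + 1 := by
    push_cast [Nat.cast_sub htn]; ring
  have e5 : (2 * (l.length : ℤ) + 2 * (t : ℤ)) = 2 * ((l.length + t : ℕ) : ℤ) := by push_cast; ring
  have e2 : (2 * ((l.length + t : ℕ) : ℤ)) = 2 * (l.length : ℤ) + ((2 * t : ℕ) : ℤ) := by push_cast; ring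
  rw [e1, e3, e5, e2, List.append_assoc, List.append_assoc, List.append_assoc,
    ← List.append_assoc (run _ _ (2 * t)), run_append, show 2 * t + (2 * (n - t) + 1) = 2 * n + 1 by omega]

/-- **A complete shape ending at an even position is an encoded family walk** (up to the mirror).
[cite: DuminilCopinSmirnov2012, §3 (Fig. 3)] -/
theorem Shp.finish {X : List (Bool × ℤ)} (hX : Shp X) {f : Bool} {e : ℤ} (hlast : X.getLast? = some (f, e))
    (he : e % 2 = 0) (hfe : f = false → e ≠ 0) :
    ∃ s : ℤ, (s = 1 ∨ s = -1) ∧ ∃ left l right, Adm left l right ∧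
      X = (encode left l right).map (smap s) ∧ f = frail left l right ∧ e = s * (2 * (l.length : ℤ)) := by
  rcases hX with ⟨left, l, k, hk, rfl⟩ | ⟨left, l, n, j, hj1, hj2, hj3, rfl⟩
  · rcases (by omega : k = 0 ∨ k = 1 ∨ k = 2) with rfl | rfl | rfl
    · rw [getLast?_shapeT3_zero, Option.some.injEq, Prod.mk.injEq] at hlast
      obtain ⟨rfl, rfl⟩ := hlast
      rcases eq_or_ne l [] with rfl | hl
      · cases left with
        | none => exact absurd rfl (hfe (by simp [wend]) )
        | some kk =>
          refine ⟨-1, Or.inr rfl, none, [], some kk, Or.inr ⟨rfl, rfl⟩, ?_, by simp [frail, wend], by simp⟩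
          rw [← map_smap_neg_pre_some, map_smap_smap (Or.inr rfl)]
          simp [shapeT3, weave, pblock]
      · refine ⟨1, Or.inl rfl, left, l, none, Or.inl hl, ?_, by simp [frail], by simp⟩
        rw [map_smap_one]; simp [shapeT3, encode, pblock]
    · rw [getLast?_shapeT3_one, Option.some.injEq, Prod.mk.injEq] at hlast
      obtain ⟨-, rfl⟩ := hlast
      exfalso; omega
    · rw [getLast?_shapeT3_two, Option.some.injEq, Prod.mk.injEq] at hlast
      obtain ⟨-, rfl⟩ := hlast
      exfalso; omega
  · rw [getLast?_shapeT4 _ _ _ hj3, Option.some.injEq, Prod.mk.injEq] at hlast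
    obtain ⟨rfl, rfl⟩ := hlast
    obtain ⟨t, ht⟩ : ∃ t : ℕ, j = 2 * (l.length : ℤ) + 2 * (t : ℤ) := ⟨((j - 2 * l.length) / 2).toNat, by omega⟩
    have htn : t ≤ n := by omega
    have ht1 : l = [] → 1 ≤ t := fun h => by subst h; have := hj2 rfl; simp at ht; omega
    subst ht
    refine ⟨1, Or.inl rfl, left, l ++ List.replicate t (wend left.isSome l), some (n - t), Or.inl ?_, ?_,
      by simp [frail, wend_append, wend_replicate], by push_cast [List.length_append, List.length_replicate]; ring⟩
    · rcases eq_or_ne l [] with rfl | hl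
      · obtain ⟨t', rfl⟩ := Nat.exists_eq_succ_of_ne_zero (by have := ht1 rfl; omega : t ≠ 0)
        simp [List.replicate_succ]
      · simp [hl]
    · rw [map_smap_one]; exact shapeT4_eq_encode left l n t htn

/-! ### §14. Every self-avoiding ladder walk from the origin has a shape -/

/-- **The shape invariant**: every `LAdj`-chain from `(⊥, 0)` without repetition is, up to the mirror,
of shape T3 or T4. [cite: DuminilCopinSmirnov2012, §3 (Fig. 3)] -/
theorem shp_of_walk : ∀ (A : List (Bool × ℤ)), A.head? = some (false, 0) → A.IsChain LAdj → A.Nodup →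
    ∃ s : ℤ, (s = 1 ∨ s = -1) ∧ ∃ X, Shp X ∧ A = X.map (smap s) := by
  intro A
  induction A using List.reverseRecOn with
  | nil => intro h; simp at h
  | append_singleton A' v ih =>
    intro h0 hch hnd
    rcases eq_or_ne A' [] with rfl | hne
    · simp only [List.nil_append, List.head?_cons, Option.some.injEq] at h0
      subst h0
      exact ⟨1, Or.inl rfl, shapeT3 none [] 0, Or.inl ⟨none, [], 0, by norm_num, rfl⟩,
        by simp [shapeT3, pre, weave, pblock, smap]⟩
    · have h0' : A'.head? = some (false, 0) := by rwa [List.head?_append_of_ne_nil _ hne] at h0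
      rw [List.isChain_append] at hch
      obtain ⟨hch', -, hlink⟩ := hch
      have hnd' : A'.Nodup := (List.nodup_append.1 hnd).1
      have hv : v ∉ A' := fun h => (List.nodup_append.1 hnd).2.2 v h v (by simp) rfl
      obtain ⟨s, hs, X, hX, rfl⟩ := ih h0' hch' hnd'
      obtain ⟨a, ha⟩ : ∃ a, X.getLast? = some a :=
        Option.ne_none_iff_exists'.1 (List.getLast?_eq_none_iff.not.2 (by rintro rfl; simp at hne))
      have hlast : (X.map (smap s)).getLast? = some (smap s a) := by rw [List.getLast?_map, ha]; rfl
      have hadj : LAdj (smap s a) v := hlink _ (by rw [hlast]; rfl) _ (by simp)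
      have hadj' : LAdj a (smap s v) := by
        have := hadj.smap hs
        rwa [smap_smap hs] at this
      have hv' : smap s v ∉ X := by
        intro h
        apply hv
        have := List.mem_map_of_mem (f := smap s) h
        rwa [smap_smap hs] at this
      obtain ⟨s', hs', X', hX', hXv⟩ := hX.step ha hadj' hv'
      refine ⟨s * s', ?_, X', hX', ?_⟩
      · rcases hs with rfl | rfl <;> rcases hs' with rfl | rfl <;> norm_num
      · have := congrArg (List.map (smap s)) hXv
        rw [List.map_append, List.map_singleton, smap_smap hs, List.map_map] at this
        rw [this]
        exact List.map_congr_left fun b _ => (smap_mul s s' b)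


/-! ### §15. Completeness: every `β`/`α`-walk of `S_{2,L}` is a family walk; the upper bounds -/

/-- A word is in `bwords` of its length. [folklore] -/
private theorem mem_bwords_self (l : List Bool) : l ∈ bwords l.length := by
  induction l with
  | nil => simp [bwords]
  | cons b l ih =>
    rw [List.length_cons, bwords, Finset.mem_union, Finset.mem_map, Finset.mem_map]
    cases b
    · exact Or.inl ⟨l, ih, rfl⟩
    · exact Or.inr ⟨l, ih, rfl⟩

/-- The deepest vertex of the left excursion. [cite: DuminilCopinSmirnov2012, §3 (Fig. 3)] -/
theorem mem_encode_left (k : ℕ) (l : List Bool) (right : Option ℕ) :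
    (false, -(2 * (k : ℤ) + 1)) ∈ encode (some k) l right := by
  rw [encode, List.mem_append, List.mem_append]
  left; left
  simp only [pre, Option.elim_some, List.mem_cons, excL, List.mem_append, List.mem_map, List.mem_range]
  right; left
  exact ⟨2 * k, by omega, by simp⟩

/-- The farthest vertex of the right excursion. [cite: DuminilCopinSmirnov2012, §3 (Fig. 3)] -/
theorem mem_encode_right (left : Option ℕ) (l : List Bool) (k : ℕ) :
    (wend left.isSome l, 2 * (l.length : ℤ) + 1 + 2 * k) ∈ encode left l (some k) := by
  rw [encode, List.mem_append]
  right
  simp only [Option.elim_some, excR, List.mem_append, List.mem_map, List.mem_range]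
  left
  exact ⟨2 * k, by omega, by simp⟩

/-- **COMPLETENESS.** Every mid-edge walk of `S_{2,L}` exiting through `β` or `α` is a family walk `fw q` with
parameters in `paramsB (L+2)` resp. `paramsA (L+2)`. [cite: DuminilCopinSmirnov2012, §3 (S_{T,L}, α, β)] -/
theorem exists_param_of_mem {L : ℕ} {P : List HV} (hP : P ∈ midWalks (stripV 2 L))
    (hd : IsBetaDart 2 (finalDart P) ∨ IsAlphaDart (finalDart P)) :
    ∃ q : Param, fw q = P ∧ (IsBetaDart 2 (finalDart P) → q ∈ paramsB (L + 2)) ∧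
      (IsAlphaDart (finalDart P) → q ∈ paramsA (L + 2)) := by
  obtain ⟨A, f, e, hA0, hch, hnd, hbd, hlast, he, hfe, hP, hβ, hα⟩ := exists_abs_of_mem hP hd
  obtain ⟨s, hs, X, hX, hAX⟩ := shp_of_walk A hA0 hch hnd
  have hs0 : s ≠ 0 := by rcases hs with rfl | rfl <;> norm_num
  -- the last entry of `X`
  have hXlast : X.getLast? = some (f, s * e) := by
    have h1 : (X.map (smap s)).getLast? = some (f, e) := by rw [← hAX]; exact hlast
    rw [List.getLast?_map] at h1
    obtain ⟨a, ha, ha'⟩ := Option.map_eq_some_iff.1 h1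
    rw [ha]
    obtain ⟨r, p⟩ := a
    simp only [smap, Prod.mk.injEq] at ha'
    obtain ⟨rfl, rfl⟩ := ha'
    congr 1; ext <;> simp
    rcases hs with rfl | rfl <;> ring
  have hse : (s * e) % 2 = 0 := by rcases hs with rfl | rfl <;> omega
  have hsfe : f = false → s * e ≠ 0 := fun hf => mul_ne_zero hs0 (hfe hf)
  obtain ⟨s', hs', left, l, right, hadm, hXq, hfq, heq⟩ := hX.finish hXlast hse hsfe
  -- assemble: `P = fw (s * s', left, l, right)`
  set σ := s * s' with hσ
  have hσ1 : σ = 1 ∨ σ = -1 := by rcases hs with rfl | rfl <;> rcases hs' with rfl | rfl <;> norm_num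
  have hAenc : A = (encode left l right).map (smap σ) := by
    rw [hAX, hXq, List.map_map]
    exact List.map_congr_left fun b _ => smap_mul s s' b
  have heσ : e = σ * (2 * (l.length : ℤ)) := by
    have : s * (s * e) = s * (s' * (2 * (l.length : ℤ))) := by rw [heq]
    have hss : s * s = 1 := by rcases hs with rfl | rfl <;> norm_num
    calc e = s * s * e := by rw [hss, one_mul]
      _ = s * (s * e) := by ring
      _ = σ * (2 * (l.length : ℤ)) := by rw [this, hσ]; ring
  refine ⟨(σ, left, l, right), ?_, fun hb => ?_, fun ha => ?_⟩
  · rw [fw, famWalk, hP, hAenc, ← hfq, heσ]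
  · -- bounds and membership in `paramsB (L+2)`
    have hbdd : ∀ a ∈ encode left l right, |a.2| ≤ 2 * (L : ℤ) + 3 := by
      intro a ha
      have := hbd (smap σ a) (by rw [hAenc]; exact List.mem_map_of_mem ha)
      simp only [smap_snd, abs_mul] at this
      have h1 : |σ| = 1 := by rcases hσ1 with h | h <;> simp [h]
      rwa [h1, one_mul] at this
    have hleft : ∀ k, left = some k → k < L + 2 := by
      intro k hk; subst hk
      have := hbdd _ (mem_encode_left k l right)
      rw [abs_le] at this; omega
    have hl : l.length ≤ L + 1 := by
      have := hbdd _ (List.mem_of_mem_getLast? (getLast?_encode left l right))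
      rw [abs_le] at this; push_cast at this; omega
    have hright : ∀ k, right = some k → k < L + 2 := by
      intro k hk; subst hk
      have := hbdd _ (mem_encode_right left l k)
      rw [abs_le] at this; push_cast at this; omega
    have hfr : frail left l right = true := hfq ▸ hβ hb
    rw [paramsB, Finset.mem_union]
    rcases eq_or_ne l [] with rfl | hlne
    · -- the walks exiting straight above `a`
      rcases hadm with h | ⟨rfl, hr⟩
      · exact absurd rfl h
      obtain ⟨k, hk⟩ := Option.isSome_iff_exists.1 hr
      subst hk
      right
      simp only [paramsZ, signs, Finset.mem_product, Finset.mem_insert, Finset.mem_singleton, Finset.mem_image,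
        Finset.mem_range]
      exact ⟨hσ1, trivial, trivial, k, hright k rfl, rfl⟩
    · left
      rw [Finset.mem_filter]
      refine ⟨?_, hfr⟩
      simp only [paramsW, signs, optN, wordsN, Finset.mem_product, Finset.mem_insert, Finset.mem_singleton,
        Finset.mem_insertNone, Finset.mem_range, Finset.mem_biUnion]
      refine ⟨hσ1, fun k hk => hleft k (Option.mem_def.1 hk), ⟨l.length - 1, by
        have := List.length_pos_of_ne_nil hlne; omega, ?_⟩, fun k hk => hright k (Option.mem_def.1 hk)⟩
      have := mem_bwords_self l
      rwa [show l.length - 1 + 1 = l.length from Nat.succ_pred_eq_of_pos (List.length_pos_of_ne_nil hlne)]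
  · have hbdd : ∀ a ∈ encode left l right, |a.2| ≤ 2 * (L : ℤ) + 3 := by
      intro a ha'
      have := hbd (smap σ a) (by rw [hAenc]; exact List.mem_map_of_mem ha')
      simp only [smap_snd, abs_mul] at this
      have h1 : |σ| = 1 := by rcases hσ1 with h | h <;> simp [h]
      rwa [h1, one_mul] at this
    have hleft : ∀ k, left = some k → k < L + 2 := by
      intro k hk; subst hk
      have := hbdd _ (mem_encode_left k l right)
      rw [abs_le] at this; omega
    have hl : l.length ≤ L + 1 := by
      have := hbdd _ (List.mem_of_mem_getLast? (getLast?_encode left l right))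
      rw [abs_le] at this; push_cast at this; omega
    have hright : ∀ k, right = some k → k < L + 2 := by
      intro k hk; subst hk
      have := hbdd _ (mem_encode_right left l k)
      rw [abs_le] at this; push_cast at this; omega
    have hfr : frail left l right = false := hfq ▸ hα ha
    have hlne : l ≠ [] := by
      rintro rfl
      rcases hadm with h | ⟨rfl, hr⟩
      · exact h rfl
      · obtain ⟨k, hk⟩ := Option.isSome_iff_exists.1 hr
        subst hk
        simp [frail, wend] at hfr
    rw [paramsA, Finset.mem_filter]
    refine ⟨?_, hfr⟩
    simp only [paramsW, signs, optN, wordsN, Finset.mem_product, Finset.mem_insert, Finset.mem_singleton,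
      Finset.mem_insertNone, Finset.mem_range, Finset.mem_biUnion]
    refine ⟨hσ1, fun k hk => hleft k (Option.mem_def.1 hk), ⟨l.length - 1, by
      have := List.length_pos_of_ne_nil hlne; omega, ?_⟩, fun k hk => hright k (Option.mem_def.1 hk)⟩
    have := mem_bwords_self l
    rwa [show l.length - 1 + 1 = l.length from Nat.succ_pred_eq_of_pos (List.length_pos_of_ne_nil hlne)]

/-- **`B_{2,L}(x)` is at most the `β`-family partial sum with parameters `< L+2`** (`x ≥ 0`).
[cite: DuminilCopinSmirnov2012, §3 (B_{T,L})] -/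
theorem stripB_two_le_sum {x : ℝ} (hx : 0 ≤ x) (L : ℕ) :
    stripB 2 L x ≤ ∑ q ∈ paramsB (L + 2), x ^ qlen q := by
  have h1 : ∑ q ∈ paramsB (L + 2), x ^ qlen q = ∑ P ∈ (paramsB (L + 2)).image fw, x ^ mwLen P := by
    rw [Finset.sum_image (fw_injOn_paramsB (L + 2))]
    refine Finset.sum_congr rfl fun q _ => ?_
    rw [fw, mwLen_famWalk, qlen]
  rw [h1, stripB]
  refine Finset.sum_le_sum_of_subset_of_nonneg (fun P hP => ?_) fun P _ _ => pow_nonneg hx _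
  rw [Finset.mem_filter] at hP
  obtain ⟨q, hq, hqB, -⟩ := exists_param_of_mem hP.1 (Or.inl hP.2)
  exact Finset.mem_image.2 ⟨q, hqB hP.2, hq⟩

/-- **`A_{2,L}(x)` is at most the `α`-family partial sum with parameters `< L+2`** (`x ≥ 0`).
[cite: DuminilCopinSmirnov2012, §3 (A_{T,L})] -/
theorem stripA_two_le_sum {x : ℝ} (hx : 0 ≤ x) (L : ℕ) :
    stripA 2 L x ≤ ∑ q ∈ paramsA (L + 2), x ^ qlen q := by
  have h1 : ∑ q ∈ paramsA (L + 2), x ^ qlen q = ∑ P ∈ (paramsA (L + 2)).image fw, x ^ mwLen P := by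
    rw [Finset.sum_image (fw_injOn_paramsA (L + 2))]
    refine Finset.sum_congr rfl fun q _ => ?_
    rw [fw, mwLen_famWalk, qlen]
  rw [h1, stripA]
  refine Finset.sum_le_sum_of_subset_of_nonneg (fun P hP => ?_) fun P _ _ => pow_nonneg hx _
  rw [Finset.mem_filter] at hP
  obtain ⟨q, hq, -, hqA⟩ := exists_param_of_mem hP.1 (Or.inr hP.2)
  exact Finset.mem_image.2 ⟨q, hqA hP.2, hq⟩

/-- The parameter sets grow with `N`. [folklore] -/
private theorem paramsW_mono {N M : ℕ} (h : N ≤ M) : paramsW N ⊆ paramsW M := by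
  have ho : optN N ⊆ optN M := by
    intro o ho
    rw [optN, Finset.mem_insertNone] at ho ⊢
    exact fun a ha => Finset.mem_range.2 ((Finset.mem_range.1 (ho a ha)).trans_le h)
  have hw : wordsN N ⊆ wordsN M := by
    intro l hl
    rw [wordsN, Finset.mem_biUnion] at hl ⊢
    obtain ⟨n, hn, hl⟩ := hl
    exact ⟨n, Finset.mem_range.2 ((Finset.mem_range.1 hn).trans_le h), hl⟩
  exact Finset.product_subset_product le_rfl (Finset.product_subset_product ho (Finset.product_subset_product hw ho))

/-- Helper `paramsB_mono` for the width-two classification. [folklore] -/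
private theorem paramsB_mono {N M : ℕ} (h : N ≤ M) : paramsB N ⊆ paramsB M := by
  refine Finset.union_subset_union (Finset.filter_subset_filter _ (paramsW_mono h)) ?_
  refine Finset.product_subset_product le_rfl (Finset.product_subset_product le_rfl
    (Finset.product_subset_product le_rfl (Finset.image_subset_image (Finset.range_subset_range.2 h))))

/-- Helper `paramsA_mono` for the width-two classification. [folklore] -/
private theorem paramsA_mono {N M : ℕ} (h : N ≤ M) : paramsA N ⊆ paramsA M :=
  Finset.filter_subset_filter _ (paramsW_mono h)

/-- **UPPER BOUND: `B_{2,L}(x) ≤ B₂(x)`** for every subcritical `x` (`0 ≤ x < 1`, `x² + x³ < 1`) and every `L`.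
[cite: DuminilCopinSmirnov2012, §3 (B_{T,L}, B_T)] -/
theorem stripB_two_le_limB {x : ℝ} (hx0 : 0 ≤ x) (hx1 : x < 1) (ha : x ^ 2 + x ^ 3 < 1) (L : ℕ) :
    stripB 2 L x ≤ limB x := by
  have hmono : Monotone fun N => ∑ q ∈ paramsB N, x ^ qlen q := fun N M h =>
    Finset.sum_le_sum_of_subset_of_nonneg (paramsB_mono h) fun _ _ _ => pow_nonneg hx0 _
  exact (stripB_two_le_sum hx0 L).trans (hmono.ge_of_tendsto (tendsto_sum_paramsB hx0 hx1 ha) (L + 2))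

/-- **UPPER BOUND: `A_{2,L}(x) ≤ A₂(x)`** for every subcritical `x` and every `L`.
[cite: DuminilCopinSmirnov2012, §3 (A_{T,L}, A_T)] -/
theorem stripA_two_le_limA {x : ℝ} (hx0 : 0 ≤ x) (hx1 : x < 1) (ha : x ^ 2 + x ^ 3 < 1) (L : ℕ) :
    stripA 2 L x ≤ 2 * (x * EA x) := by
  have hmono : Monotone fun N => ∑ q ∈ paramsA N, x ^ qlen q := fun N M h =>
    Finset.sum_le_sum_of_subset_of_nonneg (paramsA_mono h) fun _ _ _ => pow_nonneg hx0 _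
  exact (stripA_two_le_sum hx0 L).trans (hmono.ge_of_tendsto (tendsto_sum_paramsA hx0 hx1 ha) (L + 2))

/-- **`B_{2,L}(x) ↑ B₂(x)`** as `L → ∞`, for every subcritical `x`. [cite: DuminilCopinSmirnov2012, §3 (B_T = lim_L B_{T,L})] -/
theorem tendsto_stripB_two_limB {x : ℝ} (hx0 : 0 ≤ x) (hx1 : x < 1) (ha : x ^ 2 + x ^ 3 < 1) :
    Tendsto (fun L : ℕ => stripB 2 L x) atTop (𝓝 (limB x)) := by
  have hmono : Monotone fun L : ℕ => stripB 2 L x := fun a b hab => stripB_mono_L hx0 hab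
  have hbdd : BddAbove (Set.range fun L : ℕ => stripB 2 L x) :=
    ⟨limB x, by rintro _ ⟨L, rfl⟩; exact stripB_two_le_limB hx0 hx1 ha L⟩
  have h := tendsto_atTop_ciSup hmono hbdd
  have heq : (⨆ L : ℕ, stripB 2 L x) = limB x :=
    le_antisymm (ciSup_le fun L => stripB_two_le_limB hx0 hx1 ha L)
      (limB_le_of_stripB_le hx0 hx1 ha fun L => le_ciSup hbdd L)
  rwa [heq] at h

/-- **`A_{2,L}(x) ↑ A₂(x)`** as `L → ∞`, for every subcritical `x`. [cite: DuminilCopinSmirnov2012, §3 (A_T = lim_L A_{T,L})] -/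
theorem tendsto_stripA_two_limA {x : ℝ} (hx0 : 0 ≤ x) (hx1 : x < 1) (ha : x ^ 2 + x ^ 3 < 1) :
    Tendsto (fun L : ℕ => stripA 2 L x) atTop (𝓝 (2 * (x * EA x))) := by
  have hmono : Monotone fun L : ℕ => stripA 2 L x := fun a b hab => stripA_mono_L hx0 hab
  have hbdd : BddAbove (Set.range fun L : ℕ => stripA 2 L x) :=
    ⟨2 * (x * EA x), by rintro _ ⟨L, rfl⟩; exact stripA_two_le_limA hx0 hx1 ha L⟩
  have h := tendsto_atTop_ciSup hmono hbdd
  have heq : (⨆ L : ℕ, stripA 2 L x) = 2 * (x * EA x) :=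
    le_antisymm (ciSup_le fun L => stripA_two_le_limA hx0 hx1 ha L)
      (limA_le_of_stripA_le hx0 hx1 ha fun L => le_ciSup hbdd L)
  rwa [heq] at h
set_option maxHeartbeats 400000 in
/-- **At the strip's own critical fugacity and beyond (`x² + x³ ≥ 1`, i.e. `x ≥ 1/ρ` with `ρ³ = ρ + 1` the
plastic number), for `x ≤ 1`, the `B_{2,L}(x)` are unbounded**: `B_{2,2N+2}(x) ≥ x⁴·N`.
[cite: DuminilCopinSmirnov2012, §3 (B_{T,L})] -/
theorem stripB_two_ge_of_critical {x : ℝ} (hx0 : 0 ≤ x) (hx1 : x ≤ 1) (ha : 1 ≤ x ^ 2 + x ^ 3) (N : ℕ) :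
    x ^ 4 * N ≤ stripB 2 (2 * (N + 1)) x := by
  have h := sum_paramsB_le_stripB hx0 (N + 1)
  rw [sum_paramsB] at h
  have hR : x ^ 3 ≤ rsum x (N + 1) := by
    rw [rsum, Finset.sum_range_succ']
    have : 0 ≤ ∑ k ∈ Finset.range N, x ^ (4 * (k + 1) + 3) := Finset.sum_nonneg fun k _ => pow_nonneg hx0 _
    simpa using this
  have hb0 : 0 ≤ x ^ 2 - x ^ 3 := by nlinarith [pow_nonneg hx0 2]
  have hE : (N : ℝ) / 2 ≤ sE x (N + 1) := by
    rw [sE]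
    have : ∀ n ∈ Finset.range (N + 1), (1 : ℝ) / 2 ≤ ((x ^ 2 + x ^ 3) ^ (n + 1) + (x ^ 2 - x ^ 3) ^ (n + 1)) / 2 := by
      intro n _
      have h1 : 1 ≤ (x ^ 2 + x ^ 3) ^ (n + 1) := one_le_pow₀ ha
      have h2 : 0 ≤ (x ^ 2 - x ^ 3) ^ (n + 1) := pow_nonneg hb0 _
      linarith
    calc (N : ℝ) / 2 ≤ ∑ _n ∈ Finset.range (N + 1), (1 : ℝ) / 2 := by simp; linarith
      _ ≤ _ := Finset.sum_le_sum this
  have hO : 0 ≤ sO x (N + 1) := by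
    rw [sO]
    refine Finset.sum_nonneg fun n _ => ?_
    have : (x ^ 2 - x ^ 3) ^ (n + 1) ≤ (x ^ 2 + x ^ 3) ^ (n + 1) :=
      pow_le_pow_left₀ hb0 (by nlinarith [pow_nonneg hx0 3]) _
    linarith
  generalize rsum x (N + 1) = R at h hR
  generalize sE x (N + 1) = E at h hE
  generalize sO x (N + 1) = O at h hO
  have hR0 : 0 ≤ R := le_trans (pow_nonneg hx0 3) hR
  have hE0 : 0 ≤ E := le_trans (by positivity) hE
  have k1 : 2 * x * (x ^ 3 * ((N : ℝ) / 2)) ≤ 2 * x * (R * E) :=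
    mul_le_mul_of_nonneg_left (mul_le_mul hR hE (by positivity : (0 : ℝ) ≤ (N : ℝ) / 2) hR0)
      (by linarith : (0 : ℝ) ≤ 2 * x)
  have k2 : 0 ≤ x * O := mul_nonneg hx0 hO
  have k3 : 0 ≤ x * (R * E) := mul_nonneg hx0 (mul_nonneg hR0 hE0)
  have k4 : 0 ≤ x * (R * (R * O)) := mul_nonneg hx0 (mul_nonneg hR0 (mul_nonneg hR0 hO))
  have k5 : 0 ≤ x * R := mul_nonneg hx0 hR0
  have e1 : 2 * x * (x ^ 3 * ((N : ℝ) / 2)) = x ^ 4 * N := by ring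
  nlinarith [k1, k2, k3, k4, k5, e1, h]

end W2

/-! ### §16. The width-two strip solved: `B_{2,L}(x) ↑ P_B(x)/Q(x)`, `A_{2,L}(x) ↑ P_A(x)/Q(x)` below the
inverse plastic number, divergence at and above it -/

/-- The denominators of the width-two generating functions do not vanish in the subcritical range.
[cite: BeatonGuttmannJensen2012, §2 (Q(z) = (1−z⁴)²(1−2z²+z⁴−z⁶))] -/
theorem stripTwo_denoms {x : ℝ} (hx0 : 0 ≤ x) (hx1 : x < 1) (ha : x ^ 2 + x ^ 3 < 1) :
    1 - x ^ 4 ≠ 0 ∧ 1 - (x ^ 2 + x ^ 3) ≠ 0 ∧ 1 - (x ^ 2 - x ^ 3) ≠ 0 := by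
  have h4 : x ^ 4 < 1 := pow_lt_one₀ hx0 hx1 (by norm_num)
  have h2 : x ^ 2 < 1 := pow_lt_one₀ hx0 hx1 (by norm_num)
  refine ⟨by linarith, by linarith, ?_⟩
  nlinarith [pow_nonneg hx0 3]

open W2 in
/-- **THE WIDTH-TWO STRIP SOLVED (bridges): `B_{2,L}(x) → B₂(x) = P_B(x)/Q(x)`** as `L → ∞`, for every
fugacity `0 ≤ x < 1` with `x² + x³ < 1`, where `P_B = 4x⁴ − 8x⁸ + 4x¹⁰ + 4x¹² − 2x¹⁴` and
`Q = (1−x⁴)²(1−x²−x³)(1−x²+x³)` — a proof of the width-two ("width 1" in their numbering) bridge generating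
function reported by Beaton–Guttmann–Jensen: every self-avoiding bridge of the strip is one of the
excursion–weave–excursion walks (`W2.exists_param_of_mem`), whose generating function is this rational
function. [cite: BeatonGuttmannJensen2012, §2 (B_1(z), their width 1 = width 2 here); DuminilCopinSmirnov2012, §3 (B_{T,L})] -/
theorem tendsto_stripB_two {x : ℝ} (hx0 : 0 ≤ x) (hx1 : x < 1) (ha : x ^ 2 + x ^ 3 < 1) :
    Tendsto (fun L : ℕ => stripB 2 L x) atTop
      (𝓝 ((4 * x ^ 4 - 8 * x ^ 8 + 4 * x ^ 10 + 4 * x ^ 12 - 2 * x ^ 14) /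
        ((1 - x ^ 4) ^ 2 * (1 - (x ^ 2 + x ^ 3)) * (1 - (x ^ 2 - x ^ 3))))) := by
  obtain ⟨h1, h2, h3⟩ := stripTwo_denoms hx0 hx1 ha
  rw [← limB_eq_div h1 h2 h3]
  exact tendsto_stripB_two_limB hx0 hx1 ha

open W2 in
/-- **THE WIDTH-TWO STRIP SOLVED (escapes): `A_{2,L}(x) → A₂(x) = P_A(x)/Q(x)`**,
`P_A = 2x³ − 2x⁵ + 2x⁷ + 6x⁹ − 8x¹¹ + 2x¹⁵`, same `Q`, same range.
[cite: BeatonGuttmannJensen2012, §2 (A_1(z), their width 1 = width 2 here); DuminilCopinSmirnov2012, §3 (A_{T,L})] -/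
theorem tendsto_stripA_two {x : ℝ} (hx0 : 0 ≤ x) (hx1 : x < 1) (ha : x ^ 2 + x ^ 3 < 1) :
    Tendsto (fun L : ℕ => stripA 2 L x) atTop
      (𝓝 ((2 * x ^ 3 - 2 * x ^ 5 + 2 * x ^ 7 + 6 * x ^ 9 - 8 * x ^ 11 + 2 * x ^ 15) /
        ((1 - x ^ 4) ^ 2 * (1 - (x ^ 2 + x ^ 3)) * (1 - (x ^ 2 - x ^ 3))))) := by
  obtain ⟨h1, h2, h3⟩ := stripTwo_denoms hx0 hx1 ha
  rw [← limA_eq_div h1 h2 h3]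
  exact tendsto_stripA_two_limA hx0 hx1 ha

open W2 in
/-- Every `B_{2,L}(x)` is below the limit `P_B(x)/Q(x)` (subcritical `x`). [cite: DuminilCopinSmirnov2012, §3 (B_{T,L} ≤ B_T)] -/
theorem stripB_two_le {x : ℝ} (hx0 : 0 ≤ x) (hx1 : x < 1) (ha : x ^ 2 + x ^ 3 < 1) (L : ℕ) :
    stripB 2 L x ≤ (4 * x ^ 4 - 8 * x ^ 8 + 4 * x ^ 10 + 4 * x ^ 12 - 2 * x ^ 14) /
        ((1 - x ^ 4) ^ 2 * (1 - (x ^ 2 + x ^ 3)) * (1 - (x ^ 2 - x ^ 3))) := by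
  obtain ⟨h1, h2, h3⟩ := stripTwo_denoms hx0 hx1 ha
  rw [← limB_eq_div h1 h2 h3]
  exact stripB_two_le_limB hx0 hx1 ha L

open W2 in
/-- Every `A_{2,L}(x)` is below the limit `P_A(x)/Q(x)` (subcritical `x`). [cite: DuminilCopinSmirnov2012, §3 (A_{T,L} ≤ A_T)] -/
theorem stripA_two_le {x : ℝ} (hx0 : 0 ≤ x) (hx1 : x < 1) (ha : x ^ 2 + x ^ 3 < 1) (L : ℕ) :
    stripA 2 L x ≤ (2 * x ^ 3 - 2 * x ^ 5 + 2 * x ^ 7 + 6 * x ^ 9 - 8 * x ^ 11 + 2 * x ^ 15) /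
        ((1 - x ^ 4) ^ 2 * (1 - (x ^ 2 + x ^ 3)) * (1 - (x ^ 2 - x ^ 3))) := by
  obtain ⟨h1, h2, h3⟩ := stripTwo_denoms hx0 hx1 ha
  rw [← limA_eq_div h1 h2 h3]
  exact stripA_two_le_limA hx0 hx1 ha L

open W2 in
/-- **Divergence at and above the strip's critical fugacity** `x₂` (`x₂² + x₂³ = 1`, `x₂ = 1/ρ` with `ρ` the
plastic number `ρ³ = ρ + 1`): for `x₂ ≤ x ≤ 1` the `B_{2,L}(x)` are unbounded in `L`. So the radius of
convergence of the width-two bridge generating function is exactly the inverse plastic number (the pole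
`1 − x² − x³ = 0` of `Q`). [cite: BeatonGuttmannJensen2012, §2 ("the dominant pole … at z = z_c(T)")] -/
theorem stripB_two_unbounded {x : ℝ} (hx0 : 0 ≤ x) (hx1 : x ≤ 1) (ha : 1 ≤ x ^ 2 + x ^ 3) (C : ℝ) :
    ∃ L : ℕ, C ≤ stripB 2 L x := by
  have hxpos : 0 < x := by
    rcases hx0.eq_or_lt with h | h
    · subst h; norm_num at ha
    · exact h
  have hx4 : 0 < x ^ 4 := pow_pos hxpos 4
  obtain ⟨N, hN⟩ := exists_nat_ge (C / x ^ 4)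
  refine ⟨2 * (N + 1), le_trans ?_ (stripB_two_ge_of_critical hx0 hx1 ha N)⟩
  rw [div_le_iff₀ hx4] at hN
  linarith

/-- The critical equation of the width-two strip is the plastic-number equation: for `x > 0`,
`x² + x³ = 1 ↔ (1/x)³ = 1/x + 1`. [cite: BeatonGuttmannJensen2012, §2 (the dominant pole z_c(T))] -/
theorem stripTwo_critical_iff_plastic {x : ℝ} (hx : 0 < x) : x ^ 2 + x ^ 3 = 1 ↔ (x⁻¹) ^ 3 = x⁻¹ + 1 := by
  have hx0 : x ≠ 0 := hx.ne'
  constructor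
  · intro h
    field_simp
    linarith
  · intro h
    field_simp at h
    linarith

end HV

end Literature.Probability.RandomPlanarGeometry.SAW

end
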